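import Literature.NumberTheory.Automorphic.TamagawaHeckeSeries
import HarnessLib

/-!
# The sharp count of the left cosets of `K` in `Δ_m ⊆ GL_n(F)` (Macdonald, Ch. V (4.6))

Topic `NumberTheory/Automorphic`; theorems only (no definition, no named fact), on top of
`TamagawaHeckeSeries`. Setting: a field `F` with a valuation (`ValuativeRel F`) whose residue
field `𝓀 = 𝓀[F]` is finite with `q = Nat.card 𝓀` elements, a uniformizing element `ϖ`,
`K = GL_n(𝒪) = glInt n F`, `Δ_m = glIntDet n ϖ m = {y integral : |det y| = |ϖ|^m}` and
`N_m = #(Δ_m K / K)` (the finset `(finite_cosets_glIntDet hϖ m).toFinset`).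

## Main statements (all proved)

* `Literature.LinearAlgebra.Subspace.sum_neg_one_pow_mul_pow_choose_mul_card_ge_codim_mul_pow`
  (**the `q`-binomial theorem for the subspace lattice**): over a finite field with `q` elements,
  for a subspace `C ≤ W`, `∑_j (-1)^j q^{j(j-1)/2} #{Y ⊇ C : codim Y = j} x^j =
  ∏_{i < codim C} (1 - q^i x)` in any commutative ring — the polynomial form of Shimura's
  Lemma 3.23 / the Möbius function of the subspace lattice
  (`…mul_card_ge_codim` of `Literature.LinearAlgebra.Subspace.MoebiusCount` is the value at
  `x = 1`), by the same recursion `card_ge_codim_eq_add`: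
  `S_C(x) = (1 - q^{codim C - 1} x) S_{C + ke}(x)`.
* `sum_neg_one_pow_mul_card_transversalIndex_mul_pow`: the **Hecke polynomial of the trivial
  representation factorises**, `∑_{i ≤ n} (-1)^i q^{i(i-1)/2} D_i x^i = ∏_{i < n} (1 - q^i x)` with
  `D_i = #(K t_i K / K) = #{Y ≤ 𝓀ⁿ : dim Y = n - i}` (`card_transversalIndex_eq`; the transversal
  of `HeckeTransversalGL`), i.e. `D_i = q^{i(i-1)/2}`-free Gaussian binomial `[n i]_q`
  (Macdonald (1995), Ch. V §2, `μ(c_{(1^r)}) = [n r](q)`, and Ch. I §2 Ex. 3).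
* `mk_card_cosets_glIntDet_mul_prod_eq_one`, `mk_card_cosets_glIntDet_eq_prod`
  (**Macdonald, Ch. V (4.6)** — the Hecke series of the trivial spherical function,
  `ζ(s, 1) = ∏_{i=1}^{n} (1 - q^{i-1-s})⁻¹`): `∑_m N_m X^m = ∏_{i<n} (1 - q^i X)⁻¹` in `L⟦X⟧`,
  obtained from **Tamagawa's rationality theorem** (`mk_heckeDetEigenvalue_mul_heckePolynomial_eq_one`
  of `TamagawaHeckeSeries`, Shimura Thm. 3.21 / Macdonald Ch. V (4.3)) applied to the trivial
  representation, on which `T_i` acts by `D_i` and `T(ϖ^m)` by `N_m`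
  (`heckeOperator_trivial_heckeDiag`, `heckeDetOperator_trivial`).
* `card_cosets_glIntDet_le_pow_mul` (**the sharp growth of the coset count**):
  `N_m ≤ (m + 1)^n q^{(n-1) m}` (the coefficient of `X^m` in `∏_{i<n} (1 - q^i X)⁻¹` is a sum of
  `#antidiagonal`-many monomials `q^{∑ i b_i} ≤ q^{(n-1)m}`; `coeff_prod_mk_pow_le`), with the
  `Set.ncard` form `ncard_cosets_glIntDet_le_pow_mul`. This replaces the crude bound
  `N_m ≤ #(K t_1 K/K)^m` (`ncard_cosets_glIntDet_le`) — `#(K t_1 K/K) = (q^n - 1)/(q - 1) > q^{n-1}` —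
  by the true exponential rate `q^{n-1} = lim N_m^{1/m}` (Macdonald, Ch. V (2.9): the measure of
  `K ϖ^λ K` is `q^{2⟨λ,ρ⟩} v_n(q⁻¹)/v_λ(q⁻¹)`), which is what the abscissa of convergence `re s > n`
  of the unramified zeta integral and the temperedness criterion for unramified representations
  (`Literature.NumberTheory.Automorphic.isTempered_iff_forall_norm_eq_one`) require.

## References

* I. G. Macdonald, *Symmetric functions and Hall polynomials*, 2nd ed., Oxford (1995), Ch. V
  §2 (2.8)–(2.9), §4 (4.1)–(4.3), (4.6) (read in the held copy,
  `book:macdonald1995-symmetric-functions-hall-polynomials`, PDF pp. 247–250) [Macdonald1995].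
* G. Shimura, *Introduction to the arithmetic theory of automorphic functions* (1971), §3.2,
  Thm. 3.21, Lemma 3.23 [ShimuraIATAF1971].
* T. Tamagawa, *On the ζ-functions of a division algebra*, Ann. of Math. 77 (1963)
  [TamagawaAnnals1963].
-/

noncomputable section

open scoped Pointwise
open MulAction ValuativeRel Matrix Finset Module

/-! ### The `q`-binomial theorem for the lattice of subspaces -/

namespace Literature.LinearAlgebra.Subspace

variable {k W : Type*} [Field k] [Finite k] [AddCommGroup W] [Module k W] [FiniteDimensional k W]

/-- **Polynomial form of Shimura's Lemma 3.23 (the `q`-binomial theorem for the subspace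
lattice).** Over a finite field with `q` elements, for every subspace `C` of a finite-dimensional
space `W` and every element `x` of a commutative ring,
`∑_j (-1)^j q^{j(j-1)/2} #{Y ⊇ C : codim Y = j} x^j = ∏_{i < dim W - dim C} (1 - q^i x)`.
At `x = 1` this is `sum_neg_one_pow_mul_pow_choose_mul_card_ge_codim` (the Möbius function of the
subspace lattice); the proof is the same induction on the codimension through the recursion
`card_ge_codim_eq_add`, which gives `S_C(x) = (1 - q^{dim W - dim C - 1} x) S_{C + k e}(x)` for
`e ∉ C` (Shimura (1971), Lemma 3.23; Macdonald (1995), Ch. I §2 Example 3 for the Gaussian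
binomial theorem `∏_{i<m} (1 + q^i x) = ∑_j q^{j(j-1)/2} [m j]_q x^j`).
[cite: ShimuraIATAF1971, Lemma 3.23] -/
theorem sum_neg_one_pow_mul_pow_choose_mul_card_ge_codim_mul_pow {R : Type*} [CommRing R]
    (x : R) (C : Submodule k W) :
    ∑ j ∈ Finset.range (finrank k W + 1), (-1 : R) ^ j * (Nat.card k : R) ^ (j.choose 2) *
        (Nat.card {Y : Submodule k W // C ≤ Y ∧ finrank k Y + j = finrank k W} : R) * x ^ j =
      ∏ i ∈ Finset.range (finrank k W - finrank k C), (1 - (Nat.card k : R) ^ i * x) := by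
  -- strong induction on the codimension of `C`
  suffices h : ∀ (d : ℕ) (C : Submodule k W), finrank k W - finrank k C = d →
      ∑ j ∈ Finset.range (finrank k W + 1), (-1 : R) ^ j * (Nat.card k : R) ^ (j.choose 2) *
        (Nat.card {Y : Submodule k W // C ≤ Y ∧ finrank k Y + j = finrank k W} : R) * x ^ j =
      ∏ i ∈ Finset.range d, (1 - (Nat.card k : R) ^ i * x) by
    rw [h _ C rfl]
  intro d
  induction d using Nat.strong_induction_on with
  | _ d ih =>
  intro C hd
  set n := finrank k W with hn
  set q : R := (Nat.card k : R) with hq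
  by_cases hC : C = ⊤
  · -- only `j = 0` contributes, with the single subspace `Y = ⊤`; the product is empty
    subst hC
    have hd0 : d = 0 := by rw [finrank_top] at hd; omega
    subst hd0
    rw [Finset.prod_range_zero, Finset.sum_range_succ', card_ge_codim_zero]
    rw [Finset.sum_eq_zero fun j _ => ?_]
    · simp
    · rw [card_ge_codim_eq_zero ⊤ (by rw [finrank_top]; omega)]
      simp
  -- a vector outside `C`
  obtain ⟨e, he⟩ : ∃ e : W, e ∉ C := by
    by_contra! h
    exact hC (eq_top_iff.mpr fun x _ => h x)
  set C' := C ⊔ (k ∙ e) with hC'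
  have hdimC' : finrank k C' = finrank k C + 1 := finrank_sup_span_singleton he
  have hCn : finrank k C + 1 ≤ n := by
    rw [← hdimC', hn, ← finrank_top (R := k) (M := W)]
    exact Submodule.finrank_mono le_top
  obtain ⟨d, rfl⟩ : ∃ d', d = d' + 1 := ⟨d - 1, by omega⟩
  -- the induction hypothesis for `C'`
  have ih' := ih (n - finrank k C') (by omega) C' rfl
  have hdC' : n - finrank k C' = d := by omega
  rw [hdC'] at ih'
  -- abbreviations for the graded counts
  set A : ℕ → R := fun j =>
    (Nat.card {Y : Submodule k W // C ≤ Y ∧ finrank k Y + j = n} : R) with hA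
  set A' : ℕ → R := fun j =>
    (Nat.card {Y : Submodule k W // C' ≤ Y ∧ finrank k Y + j = n} : R) with hA'
  -- the recursion, termwise, for `j + 1`
  have hrec : ∀ j, A (j + 1) = A' (j + 1) + q ^ (n - finrank k C - (j + 1)) * A' j := by
    intro j
    simp only [hA, hA', hq]
    rw [card_ge_codim_eq_add C he (Nat.le_add_left 1 j), Nat.add_sub_cancel]
    push_cast
    ring
  -- vanishing of `A' j` beyond the maximal codimension `n - dim C - 1`
  have hA'0 : ∀ j, n - finrank k C - 1 < j → A' j = 0 := by
    intro j hj
    simp only [hA']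
    rw [card_ge_codim_eq_zero C' (by omega), Nat.cast_zero]
  have hA'n : A' n = 0 := hA'0 n (by omega)
  have hS' : ∑ j ∈ Finset.range (n + 1), (-1 : R) ^ j * q ^ (j.choose 2) * A' j * x ^ j =
      ∑ j ∈ Finset.range n, (-1 : R) ^ j * q ^ (j.choose 2) * A' j * x ^ j := by
    rw [Finset.sum_range_succ, hA'n, mul_zero, zero_mul, add_zero]
  -- `S(C)(x) = (1 - q^{n - dim C - 1} x) S(C')(x)`
  have key : ∑ j ∈ Finset.range (n + 1), (-1 : R) ^ j * q ^ (j.choose 2) * A j * x ^ j =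
      (1 - q ^ (n - finrank k C - 1) * x) *
        ∑ j ∈ Finset.range (n + 1), (-1 : R) ^ j * q ^ (j.choose 2) * A' j * x ^ j := by
    rw [Finset.sum_range_succ' _ n,
      Finset.sum_range_succ' (fun j => (-1 : R) ^ j * _ * A' j * x ^ j) n]
    have h0 : A 0 = 1 := by simp only [hA]; rw [card_ge_codim_zero]; simp
    have h0' : A' 0 = 1 := by simp only [hA']; rw [card_ge_codim_zero]; simp
    simp only [h0, h0', pow_zero, Nat.choose_zero_succ, mul_one]
    have hterm : ∀ j ∈ Finset.range n,
        (-1 : R) ^ (j + 1) * q ^ ((j + 1).choose 2) * A (j + 1) * x ^ (j + 1) =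
          (-1 : R) ^ (j + 1) * q ^ ((j + 1).choose 2) * A' (j + 1) * x ^ (j + 1) -
            q ^ (n - finrank k C - 1) * x *
              ((-1 : R) ^ j * q ^ (j.choose 2) * A' j * x ^ j) := by
      intro j _
      rw [hrec j]
      by_cases hj : j ≤ n - finrank k C - 1
      · have e1 : (j + 1).choose 2 = j.choose 2 + j := by
          rw [Nat.choose_succ_left _ _ (by norm_num : 0 < 2), Nat.choose_one_right]; ring
        have hpow : q ^ ((j + 1).choose 2) * q ^ (n - finrank k C - (j + 1)) =
            q ^ (n - finrank k C - 1) * q ^ (j.choose 2) := by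
          rw [e1, ← pow_add, ← pow_add]
          congr 1
          omega
        calc (-1 : R) ^ (j + 1) * q ^ ((j + 1).choose 2) *
              (A' (j + 1) + q ^ (n - finrank k C - (j + 1)) * A' j) * x ^ (j + 1)
            = (-1 : R) ^ (j + 1) * q ^ ((j + 1).choose 2) * A' (j + 1) * x ^ (j + 1) +
                (-1 : R) ^ (j + 1) * (q ^ ((j + 1).choose 2) * q ^ (n - finrank k C - (j + 1))) *
                  A' j * x ^ (j + 1) := by ring
          _ = (-1 : R) ^ (j + 1) * q ^ ((j + 1).choose 2) * A' (j + 1) * x ^ (j + 1) +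
                (-1 : R) ^ (j + 1) * (q ^ (n - finrank k C - 1) * q ^ (j.choose 2)) *
                  A' j * x ^ (j + 1) := by rw [hpow]
          _ = _ := by ring
      · rw [hA'0 j (by omega)]
        ring
    rw [Finset.sum_congr rfl hterm, Finset.sum_sub_distrib, ← Finset.mul_sum, ← hS',
      Finset.sum_range_succ' (fun j => (-1 : R) ^ j * _ * A' j * x ^ j) n]
    simp only [h0', pow_zero, Nat.choose_zero_succ, mul_one]
    ring
  change ∑ j ∈ Finset.range (n + 1), (-1 : R) ^ j * q ^ (j.choose 2) * A j * x ^ j = _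
  rw [key, ih', Finset.prod_range_succ, show n - finrank k C - 1 = d by omega, mul_comm]

end Literature.LinearAlgebra.Subspace

namespace Literature.NumberTheory.Automorphic

variable {F : Type*} [Field F] [ValuativeRel F] {n : ℕ}

/-! ### `D_r = #(K t_r K / K)` is the number of subspaces of `𝓀ⁿ` of dimension `n - r` -/

section SubspaceCount

variable [Finite 𝓀[F]]

/-- The index set of the transversal of `K t_r K / K` (reduced echelon data with `#S = n - r`)
is equinumerous with the subspaces of `𝓀ⁿ` of dimension `n - r`
(`bijective_transversalIndex_span` of `HeckeLatticeCount`): `#(K t_r K / K) = [n r]_q`, the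
number of lattices between `ϖ 𝒪ⁿ` and `𝒪ⁿ` with quotient of dimension `n - r` (Macdonald (1995),
Ch. V §2: `μ(c_{(1^r)}) = [n r](q)`). [cite: Macdonald1995, Ch. V §2 (2.8)–(2.9)] -/
theorem card_transversalIndex_eq (r : ℕ) :
    Fintype.card (TransversalIndex n F r) =
      Nat.card {Y : Submodule 𝓀[F] (Fin n → 𝓀[F]) // Module.finrank 𝓀[F] Y = n - r} := by
  rw [← Nat.card_eq_fintype_card]
  exact Nat.card_congr (Equiv.ofBijective _ (bijective_transversalIndex_span r))

/-- The same count in the indexing of `Literature.LinearAlgebra.Subspace.MoebiusCount`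
(subspaces `Y ⊇ ⊥` of codimension `r`), for `r ≤ n`. [folklore] -/
theorem card_transversalIndex_eq_card_ge_codim {r : ℕ} (hr : r ≤ n) :
    Fintype.card (TransversalIndex n F r) =
      Nat.card {Y : Submodule 𝓀[F] (Fin n → 𝓀[F]) //
        ⊥ ≤ Y ∧ Module.finrank 𝓀[F] Y + r = Module.finrank 𝓀[F] (Fin n → 𝓀[F])} := by
  rw [card_transversalIndex_eq]
  refine Nat.card_congr (Equiv.subtypeEquivRight fun Y => ?_)
  rw [Module.finrank_fin_fun]
  constructor
  · intro h
    exact ⟨bot_le, by omega⟩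
  · rintro ⟨-, h⟩
    omega

/-- **The Hecke polynomial of the trivial representation factorises.** With
`D_i = #(K t_i K / K) = #{Y ≤ 𝓀ⁿ : dim Y = n - i}` and `q = #𝓀`, in any commutative ring
`∑_{i ≤ n} (-1)^i q^{i(i-1)/2} D_i x^i = ∏_{i < n} (1 - q^i x)` — the `q`-binomial theorem, i.e.
the statement that the trivial representation of `GL_n(F)` has the Satake (Hecke) parameters
`q^{(n-1)/2}, q^{(n-3)/2}, …, q^{(1-n)/2}` (Macdonald (1995), Ch. V §2: `μ'(e_r) = q^{r(r-1)/2} [n r](q)`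
is the `r`-th elementary symmetric function of `q^{n-1}, …, q, 1`; (3.4) with `s = ρ`).
[cite: Macdonald1995, Ch. V §2 (2.8)–(2.9)] -/
theorem sum_neg_one_pow_mul_card_transversalIndex_mul_pow {R : Type*} [CommRing R] (x : R) :
    ∑ i ∈ Finset.range (n + 1), (-1 : R) ^ i * (Nat.card 𝓀[F] : R) ^ (i.choose 2) *
        (Fintype.card (TransversalIndex n F i) : R) * x ^ i =
      ∏ i ∈ Finset.range n, (1 - (Nat.card 𝓀[F] : R) ^ i * x) := by
  have h := Literature.LinearAlgebra.Subspace.sum_neg_one_pow_mul_pow_choose_mul_card_ge_codim_mul_pow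
    (k := 𝓀[F]) (W := Fin n → 𝓀[F]) x ⊥
  rw [finrank_bot, Module.finrank_fin_fun, Nat.sub_zero] at h
  rw [← h]
  refine Finset.sum_congr rfl fun i hi => ?_
  rw [Finset.mem_range, Nat.lt_succ_iff] at hi
  rw [card_transversalIndex_eq_card_ge_codim hi, Module.finrank_fin_fun]

end SubspaceCount

/-! ### The Hecke operators on the trivial representation -/

section Trivial

variable [Finite 𝓀[F]] {ϖ : F}

omit [ValuativeRel F] [Finite 𝓀[F]] in
/-- Every vector of the trivial representation is `K`-fixed. [folklore] -/
theorem one_mem_fixedPoints_trivial (L : Type*) [Field L] (H : Subgroup (GL (Fin n) F)) :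
    (1 : L) ∈ (Representation.trivial L (GL (Fin n) F) L).fixedPoints H := by
  rw [Representation.mem_fixedPoints]
  intro g _
  rfl

/-- On the trivial representation the Hecke operator `T_r = [K t_r K]` (`r ≤ n`) is multiplication
by the number of left cosets `D_r = #(K t_r K / K)` (the sum `∑_{yK ⊆ K t_r K} ρ(y)` of
`#(K t_r K / K)` identity operators; transversal of `HeckeTransversalGL`). [folklore] -/
theorem heckeOperator_trivial_heckeDiag (hϖ : IsUniformizingElement ϖ) (L : Type*) [Field L]
    {r : ℕ} (hr : r ≤ n) :
    heckeOperator (Representation.trivial L (GL (Fin n) F) L) (glInt n F)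
        (heckeDiag n (Units.mk0 ϖ hϖ.ne_zero) r) 1 =
      (Fintype.card (TransversalIndex n F r) : L) • (1 : L) := by
  rw [heckeOperator_apply_eq_sum _ (glInt n F) _ _ (bijOn_heckeTransversal hϖ hr)
      (one_mem_fixedPoints_trivial L _), sum_heckeTransversal hϖ]
  simp only [Representation.trivial_apply]
  rw [Finset.sum_const, Finset.card_univ, nsmul_eq_mul, mul_one, smul_eq_mul, mul_one]

/-- On the trivial representation `T(ϖ^m) = ∑_{yK ⊆ Δ_m} ρ(y)` is multiplication by the number
`N_m = #(Δ_m K / K)` of left cosets in `Δ_m`. [folklore] -/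
theorem heckeDetOperator_trivial (hϖ : IsUniformizingElement ϖ) (L : Type*) [Field L] (m : ℕ) :
    heckeDetOperator (Representation.trivial L (GL (Fin n) F) L) ϖ m 1 =
      ((finite_cosets_glIntDet (n := n) hϖ m).toFinset.card : L) • (1 : L) := by
  rw [heckeDetOperator_apply_eq_sum _ m (finite_cosets_glIntDet hϖ m)]
  simp only [Representation.trivial_apply]
  rw [Finset.sum_const, nsmul_eq_mul, mul_one, smul_eq_mul, mul_one]

/-- **Tamagawa's identity for the coset counts** (Shimura, Thm. 3.21, applied to the trivial
representation): `(∑_m N_m X^m) · (∑_{i ≤ n} (-1)^i q^{i(i-1)/2} D_i X^i) = 1` in `L⟦X⟧`, where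
`N_m = #(Δ_m K/K)` and `D_i = #(K t_i K/K)`. [cite: ShimuraIATAF1971, Theorem 3.21] -/
theorem mk_card_cosets_glIntDet_mul_sum_eq_one (hϖ : IsUniformizingElement ϖ) (L : Type*)
    [Field L] :
    PowerSeries.mk (fun m => ((finite_cosets_glIntDet (n := n) hϖ m).toFinset.card : L)) *
      (∑ i ∈ Finset.range (n + 1), Polynomial.C ((-1 : L) ^ i * (Nat.card 𝓀[F] : L) ^ i.choose 2 *
        (Fintype.card (TransversalIndex n F i) : L)) * Polynomial.X ^ i : Polynomial L) = 1 :=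
  mk_heckeDetEigenvalue_mul_heckePolynomial_eq_one (Representation.trivial L (GL (Fin n) F) L) hϖ
    (one_mem_fixedPoints_trivial L _) one_ne_zero
    (τ := fun i => (Fintype.card (TransversalIndex n F i) : L))
    (fun _ hi => heckeOperator_trivial_heckeDiag hϖ L hi) (fun m => heckeDetOperator_trivial hϖ L m)

/-- **Macdonald, Ch. V (4.6), product form**: `(∑_m N_m X^m) · ∏_{i<n} (1 - q^i X) = 1` in `L⟦X⟧`
(Tamagawa's identity for the trivial representation combined with the factorisation of its Hecke
polynomial, `sum_neg_one_pow_mul_card_transversalIndex_mul_pow`). [cite: Macdonald1995, Ch. V (4.6)] -/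
theorem mk_card_cosets_glIntDet_mul_prod_eq_one (hϖ : IsUniformizingElement ϖ) (L : Type*)
    [Field L] :
    PowerSeries.mk (fun m => ((finite_cosets_glIntDet (n := n) hϖ m).toFinset.card : L)) *
      ∏ i ∈ Finset.range n, (1 - PowerSeries.C ((Nat.card 𝓀[F] : L) ^ i) * PowerSeries.X) = 1 := by
  have h := mk_card_cosets_glIntDet_mul_sum_eq_one (n := n) hϖ L
  have hpoly : (∑ i ∈ Finset.range (n + 1), Polynomial.C ((-1 : L) ^ i *
      (Nat.card 𝓀[F] : L) ^ i.choose 2 * (Fintype.card (TransversalIndex n F i) : L)) *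
        Polynomial.X ^ i : Polynomial L) =
      ∏ i ∈ Finset.range n, (1 - Polynomial.C ((Nat.card 𝓀[F] : L) ^ i) * Polynomial.X) := by
    calc (∑ i ∈ Finset.range (n + 1), Polynomial.C ((-1 : L) ^ i *
          (Nat.card 𝓀[F] : L) ^ i.choose 2 * (Fintype.card (TransversalIndex n F i) : L)) *
            Polynomial.X ^ i : Polynomial L)
        = ∑ i ∈ Finset.range (n + 1), (-1 : Polynomial L) ^ i *
            (Nat.card 𝓀[F] : Polynomial L) ^ (i.choose 2) *
              (Fintype.card (TransversalIndex n F i) : Polynomial L) * Polynomial.X ^ i := by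
          refine Finset.sum_congr rfl fun i _ => ?_
          rw [map_mul, map_mul, map_pow, map_pow, map_neg, map_one, map_natCast, map_natCast]
      _ = ∏ i ∈ Finset.range n, (1 - (Nat.card 𝓀[F] : Polynomial L) ^ i * Polynomial.X) :=
          sum_neg_one_pow_mul_card_transversalIndex_mul_pow _
      _ = ∏ i ∈ Finset.range n, (1 - Polynomial.C ((Nat.card 𝓀[F] : L) ^ i) * Polynomial.X) := by
          refine Finset.prod_congr rfl fun i _ => ?_
          rw [map_pow, map_natCast]
  have hcoe : ((∏ i ∈ Finset.range n, (1 - Polynomial.C ((Nat.card 𝓀[F] : L) ^ i) * Polynomial.X) :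
      Polynomial L) : PowerSeries L) =
      ∏ i ∈ Finset.range n, (1 - PowerSeries.C ((Nat.card 𝓀[F] : L) ^ i) * PowerSeries.X) := by
    rw [← Polynomial.coeToPowerSeries.ringHom_apply, map_prod]
    refine Finset.prod_congr rfl fun i _ => ?_
    rw [map_sub, map_one, map_mul, Polynomial.coeToPowerSeries.ringHom_apply,
      Polynomial.coeToPowerSeries.ringHom_apply, Polynomial.coe_C, Polynomial.coe_X]
  rw [hpoly, hcoe] at h
  exact h

/-- The geometric series: `(∑_m a^m X^m) (1 - a X) = 1`. [folklore] -/
theorem mk_pow_mul_one_sub_C_mul_X (L : Type*) [CommRing L] (a : L) :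
    PowerSeries.mk (fun m => a ^ m) * (1 - PowerSeries.C a * PowerSeries.X) = 1 := by
  have h := congrArg (PowerSeries.rescale a) (PowerSeries.mk_one_mul_one_sub_eq_one L)
  rw [map_mul, map_sub, map_one, PowerSeries.rescale_X, PowerSeries.rescale_mk] at h
  simpa [Pi.one_apply] using h

/-- **Macdonald, Ch. V (4.6)** (the Hecke series of the trivial spherical function,
`ζ(s, 1) = ∏_{i=1}^{n} (1 - q^{i-1-s})⁻¹`): the generating series of the coset counts is
`∑_m #(Δ_m K/K) X^m = ∏_{i<n} (1 - q^i X)⁻¹ = ∏_{i<n} ∑_m q^{im} X^m` in `L⟦X⟧`.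
[cite: Macdonald1995, Ch. V (4.6)] -/
theorem mk_card_cosets_glIntDet_eq_prod (hϖ : IsUniformizingElement ϖ) (L : Type*) [Field L] :
    PowerSeries.mk (fun m => ((finite_cosets_glIntDet (n := n) hϖ m).toFinset.card : L)) =
      ∏ i ∈ Finset.range n, PowerSeries.mk (fun m => ((Nat.card 𝓀[F] : L) ^ i) ^ m) := by
  set P := ∏ i ∈ Finset.range n, (1 - PowerSeries.C ((Nat.card 𝓀[F] : L) ^ i) * PowerSeries.X)
    with hP
  have h1 := mk_card_cosets_glIntDet_mul_prod_eq_one (n := n) hϖ L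
  have h2 : (∏ i ∈ Finset.range n, PowerSeries.mk (fun m => ((Nat.card 𝓀[F] : L) ^ i) ^ m)) * P =
      1 := by
    rw [hP, ← Finset.prod_mul_distrib]
    exact Finset.prod_eq_one fun i _ => mk_pow_mul_one_sub_C_mul_X L _
  rw [← hP] at h1
  calc PowerSeries.mk (fun m => ((finite_cosets_glIntDet (n := n) hϖ m).toFinset.card : L))
      = PowerSeries.mk (fun m => ((finite_cosets_glIntDet (n := n) hϖ m).toFinset.card : L)) *
          ((∏ i ∈ Finset.range n, PowerSeries.mk (fun m => ((Nat.card 𝓀[F] : L) ^ i) ^ m)) * P) := by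
        rw [h2, mul_one]
    _ = (∏ i ∈ Finset.range n, PowerSeries.mk (fun m => ((Nat.card 𝓀[F] : L) ^ i) ^ m)) *
          (PowerSeries.mk (fun m => ((finite_cosets_glIntDet (n := n) hϖ m).toFinset.card : L)) *
            P) := by ring
    _ = _ := by rw [h1, mul_one]

end Trivial

/-! ### The growth of the coefficients of `∏_{i<k} (1 - q^i X)⁻¹` and of `N_m` -/

section Growth

/-- The coefficient of `X^m` in `∏_{i<k} ∑_m q^{im} X^m` is at most `(m+1)^k q^{(k-1)m}` for
`q ≥ 1` (each of the at most `(m+1)^k` monomials `q^{∑ i b_i}`, `∑ b_i = m`, is `≤ q^{(k-1)m}`;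
induction on `k` through the Cauchy product). [folklore] -/
theorem coeff_prod_mk_pow_le {q : ℝ} (hq : 1 ≤ q) (k m : ℕ) :
    PowerSeries.coeff m (∏ i ∈ Finset.range k, PowerSeries.mk (fun m => (q ^ i) ^ m)) ≤
      (m + 1 : ℝ) ^ k * q ^ ((k - 1) * m) := by
  induction k generalizing m with
  | zero =>
    rw [Finset.prod_range_zero, PowerSeries.coeff_one]
    split_ifs <;> simp
  | succ k ih =>
    rw [Finset.prod_range_succ, PowerSeries.coeff_mul]
    have hq0 : (0 : ℝ) ≤ q := zero_le_one.trans hq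
    calc ∑ p ∈ antidiagonal m,
          PowerSeries.coeff p.1 (∏ i ∈ Finset.range k, PowerSeries.mk (fun m => (q ^ i) ^ m)) *
            PowerSeries.coeff p.2 (PowerSeries.mk (fun m => (q ^ k) ^ m))
        ≤ ∑ _p ∈ antidiagonal m, (m + 1 : ℝ) ^ k * q ^ (k * m) := by
          refine Finset.sum_le_sum fun p hp => ?_
          rw [Finset.HasAntidiagonal.mem_antidiagonal] at hp
          rw [PowerSeries.coeff_mk]
          calc PowerSeries.coeff p.1 (∏ i ∈ Finset.range k, PowerSeries.mk (fun m => (q ^ i) ^ m)) *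
                (q ^ k) ^ p.2
              ≤ ((p.1 + 1 : ℝ) ^ k * q ^ ((k - 1) * p.1)) * (q ^ k) ^ p.2 :=
                mul_le_mul_of_nonneg_right (ih p.1) (by positivity)
            _ = (p.1 + 1 : ℝ) ^ k * q ^ ((k - 1) * p.1 + k * p.2) := by
                rw [← pow_mul, pow_add, mul_assoc]
            _ ≤ (m + 1 : ℝ) ^ k * q ^ (k * m) := by
                refine mul_le_mul ?_ ?_ (by positivity) (by positivity)
                · exact pow_le_pow_left₀ (by positivity) (by norm_cast; omega) k
                · refine pow_le_pow_right₀ hq ?_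
                  calc (k - 1) * p.1 + k * p.2 ≤ k * p.1 + k * p.2 :=
                        Nat.add_le_add_right (Nat.mul_le_mul_right _ (Nat.sub_le k 1)) _
                    _ = k * m := by rw [← mul_add, hp]
      _ = (m + 1 : ℝ) * ((m + 1 : ℝ) ^ k * q ^ (k * m)) := by
          rw [Finset.sum_const, Finset.Nat.card_antidiagonal, nsmul_eq_mul]
          push_cast
          ring
      _ = (m + 1 : ℝ) ^ (k + 1) * q ^ ((k + 1 - 1) * m) := by
          rw [Nat.add_sub_cancel, pow_succ]
          ring

variable [Finite 𝓀[F]] {ϖ : F}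

/-- **The sharp growth of the number of left cosets in `Δ_m`** (Macdonald (1995), Ch. V (2.9) /
(4.6)): `#(Δ_m K / K) ≤ (m + 1)^n q^{(n-1) m}`, `q = #𝓀` — the exponential rate `q^{n-1}` is the
largest Hecke parameter of the trivial representation, and is attained
(`N_m ≥ q^{(n-1)m}`, the cosets `(ϖ^m b; 0 1) K`). [cite: Macdonald1995, Ch. V (4.6)] -/
theorem card_cosets_glIntDet_le_pow_mul (hϖ : IsUniformizingElement ϖ) (m : ℕ) :
    ((finite_cosets_glIntDet (n := n) hϖ m).toFinset.card : ℝ) ≤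
      (m + 1 : ℝ) ^ n * (Nat.card 𝓀[F] : ℝ) ^ ((n - 1) * m) := by
  have h := congrArg (PowerSeries.coeff m) (mk_card_cosets_glIntDet_eq_prod (n := n) hϖ ℝ)
  rw [PowerSeries.coeff_mk] at h
  rw [h]
  have hq : (1 : ℝ) ≤ Nat.card 𝓀[F] := by
    exact_mod_cast Nat.one_le_iff_ne_zero.mpr (Nat.card_pos (α := 𝓀[F])).ne'
  exact coeff_prod_mk_pow_le hq n m

/-- The same bound in `ℕ`. [cite: Macdonald1995, Ch. V (4.6)] -/
theorem card_cosets_glIntDet_le_pow_mul_nat (hϖ : IsUniformizingElement ϖ) (m : ℕ) :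
    (finite_cosets_glIntDet (n := n) hϖ m).toFinset.card ≤
      (m + 1) ^ n * Nat.card 𝓀[F] ^ ((n - 1) * m) := by
  exact_mod_cast card_cosets_glIntDet_le_pow_mul (n := n) hϖ m

/-- The same bound for `Set.ncard` of the set of cosets `Δ_m K / K ⊆ G ⧸ K`.
[cite: Macdonald1995, Ch. V (4.6)] -/
theorem ncard_cosets_glIntDet_le_pow_mul (hϖ : IsUniformizingElement ϖ) (m : ℕ) :
    {γ : GL (Fin n) F ⧸ glInt n F | γ.out ∈ glIntDet n ϖ m}.ncard ≤
      (m + 1) ^ n * Nat.card 𝓀[F] ^ ((n - 1) * m) := by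
  rw [Set.ncard_eq_toFinset_card _ (finite_cosets_glIntDet hϖ m)]
  exact card_cosets_glIntDet_le_pow_mul_nat hϖ m

end Growth

end Literature.NumberTheory.Automorphic
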